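import Summits.FinalStateConjecture.FinalStateConjecture.Theorems.DissipativeFinalMotionsFinalEraGenericIsometryTransport
import Summits.FinalStateConjecture.FinalStateConjecture.Theorems.PhotonSphereChannelsChannelsResolveTameDevelopmentsRMinkowskiMaximal
import Literature.Geometry.Lorentzian.FinalEraPackage2
import Literature.Geometry.Lorentzian.TrivialDataAdmissible
import HarnessLib

/-!
# Route DissipativeFinalMotions — crux `FinalEraGeneric` (stmt-FinalStateConjecture-17642), line `registered`:
# the crux's per-datum property HOLDS on the whole fibre over the trivial datum (anti-vacuity, kernel-checked)

The crux asserts tame-generically the per-datum property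
`P D := (∃ MGHD) ∧ ∀ MGHD 𝒟, 𝓘⁺ complete ∧ ∃ (rev-2 era `IsFinalEra₂ …`) ∧ (R) ∧ (F) ∧ (F₀)`.
Every audit of this crux (refuter `VETTING.md`, leads c4–c7, `Cruxes/FinalEraGeneric/CORE-c7.md` §3b) checked
ON PAPER that the post-maximality part of `P` is satisfiable — "consistent on Minkowski, `N = 0`" — so that no
clause-level (universal typed-defect) refutation of the crux exists. This file makes that a kernel fact:

* `isFinalEra₂_minkowski` — the Minkowski development `Minkowski.vacuumCauchyDevelopment` of the trivial datum
  `(ℝ³, δ, 0)` carries the HONEST `N = 0` rev-2 era (identity flat chart on `U₀ = E4` after `T = 0`, region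
  `O = {x⁰ ≥ 0}`, zero deviation; the construction of `BartnikGapSettling.Capture.stub_minkowskiEra`, whose
  inline lemma is private there);
* `honestOrientedEra_minkowski` — together with complete `𝓘⁺` (`minkowski_hasCompleteNullInfinity`), (R)
  (`raysStayInClosure_minkowski`: rays are straight lines with `(γ t)⁰ = t ≥ 0`), (F) (no hole) and (F₀)
  (`isFutureOriented_minkowskiDecomp`: the identity chart pushes `∂₀` to `∂ₜ`): the FULL post-maximality
  property of the crux holds at the Minkowski development;
* `honestOrientedEra_of_isMaximal` — UNCONDITIONALLY at EVERY maximal vacuum Cauchy development of the trivial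
  datum (each is isometric to Minkowski space, `Minkowski.isIsometricTo_vacuumCauchyDevelopment_of_isMaximal`;
  transport `honestOrientedEra_transport`);
* `finalEraProperty_trivialData_iff` — hence at the trivial datum `P` is EQUIVALENT to bare MGHD existence, and
  `finalEraProperty_trivialData` — `P (trivialData)` holds given only the named fact
  `choquetBruhat_geroch_exists_mghd_cauchy` (`Minkowski.isMaximal_vacuumCauchyDevelopment`);
* `exists_admissible_honestOrientedEra` — so the post-maximality property is satisfied by a vacuum Cauchy
  development of an ADMISSIBLE datum: it has no universal typed defect, and a counterexample to the crux's
  per-datum property needs a non-flat admissible datum.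

Helper lemmas (`--supports`); they do not close the crux. References: Christodoulou–Klainerman 1993, Thm. 1.0.2
(Minkowski space is its own final state); O'Neill 1983, Ch. 3, Ex. 3.25, Ch. 14, p. 402; Choquet-Bruhat–Geroch,
CMP 14 (1969), Thm. 3; Ringström 2009, Thm. 16.6; Dafermos–Luk arXiv:1710.01722, p. 8 and Conjecture 1.
-/

noncomputable section

-- `<Problem> = <Summit>` doubles the namespace component (tree-wide convention)
set_option linter.dupNamespace false

open Set Filter Topology Function
open scoped Manifold ContDiff Topology ENNReal
open Literature.Geometry.Lorentzian

namespace Summit.FinalStateConjecture.FinalStateConjecture.Theorems.DissipativeFinalMotions.FinalEraGeneric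

open Summit.FinalStateConjecture.FinalStateConjecture.Theorems.UniversalWitnessFamily.Negative
  (minkowskiExterior idFlatChart isLateChart_idFlatChart deviationExtend_idFlatChart causalFuture_range_sliceEmbed
    chronologicalPast_late minkowskiDecomp)
open Summit.FinalStateConjecture.FinalStateConjecture.Theorems.ChannelsResolveTameDevelopmentsR.TrivialDatum
  (raysStayInClosure_minkowski isFutureOriented_minkowskiDecomp)
open Summit.FinalStateConjecture.FinalStateConjecture.Theorems.WeakCosmicCensorshipMGHD.Negative
  (minkowski_hasCompleteNullInfinity)

/-! ### The honest `N = 0` era of Minkowski space -/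

/-- **The honest `N = 0` rev-2 final era of Minkowski space, inline form.** The tuple
`(N, M, a, T, δ, V, C₁, C₂, ρ₀, κ, ξ, β, U₀, B₀, B, Ψ₀, Ψ, O) = (0, !, !, 0, 1, 0, 0, 1, 1, 0, !, 0, ⊤, η on E4, !, id, !, {x⁰ ≥ 0})`
(`!` the empty family) satisfies the 31-clause predicate `CauchyDevelopment.IsFinalEra₂` in the Minkowski
development of the trivial datum: the hole-indexed clauses are vacuous, the flat chart is the identity (zero
deviation, late chart into `{x⁰ ≥ 0}`), `O = J⁺({x⁰ = 0}) ∩ I⁻({x⁰ > 0}) = {x⁰ ≥ 0}`, and exhaustion holds by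
vertical timelike segments. (Same construction as the private `isFinalEra₂_minkowski` of
`Theorems/BartnikGapSettlingCaptureStubMinkowskiEra.lean`, made public for this crux.) Christodoulou–Klainerman
1993, Thm. 1.0.2. [cite: ChristodoulouKlainerman1993, Thm. 1.0.2] -/
theorem isFinalEra₂_minkowski :
    Minkowski.vacuumCauchyDevelopment.toCauchyDevelopment.IsFinalEra₂ 0 Fin.elim0 Fin.elim0
      0 1 0 0 1 1 0 Fin.elim0 (fun _ ↦ 0) ⊤ (Minkowski.backgroundOn ⊤) (fun i ↦ i.elim0)
      idFlatChart (fun i ↦ i.elim0) minkowskiExterior := by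
  refine ⟨?_, rfl, funext fun i ↦ i.elim0, fun i ↦ i.elim0, one_pos, le_rfl, one_pos, le_rfl,
    le_rfl, one_pos, le_rfl, fun i ↦ i.elim0, fun _ _ i ↦ i.elim0, fun i ↦ i.elim0,
    MeasureTheory.integrableOn_zero, fun _ _ ↦ le_rfl, fun _ _ i ↦ i.elim0,
    isLateChart_idFlatChart, fun _ _ ↦ trivial, ?_, fun i ↦ i.elim0, fun i ↦ i.elim0,
    fun i ↦ i.elim0, fun i ↦ i.elim0, fun i ↦ i.elim0, fun i ↦ i.elim0, fun i ↦ i.elim0,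
    fun i ↦ i.elim0, ?_, fun i ↦ i.elim0, fun i ↦ i.elim0⟩
  · -- (O) `O = J⁺(ι ℝ³) ∩ I⁻(Ψ₀ {x⁰ > 0})`: `J⁺({x⁰ = 0}) = {x⁰ ≥ 0}`, `I⁻({x⁰ > 0}) = ℝ⁴`
    simp only [iUnion_of_empty, union_empty]
    refine Set.ext fun (x : E4) ↦ ⟨fun hx ↦ ⟨?_, ?_⟩, fun hx ↦ ?_⟩
    · exact (Set.ext_iff.mp causalFuture_range_sliceEmbed x).mpr hx
    · -- `I⁻({x⁰ > 0}) = ℝ⁴` and `{x⁰ > 0} ⊆ Ψ₀ {x⁰ > 0}` (the identity chart)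
      have h1 := (Set.ext_iff.mp (chronologicalPast_late 0) x).mpr (mem_univ x)
      refine LorentzianMetric.chronologicalFuture_mono
        (M := Minkowski.vacuumCauchyDevelopment.carrier) ?_ h1
      exact fun y hy ↦ ⟨⟨y, trivial⟩, hy, rfl⟩
    · exact (Set.ext_iff.mp causalFuture_range_sliceEmbed x).mp hx.1
  · -- (F3) far flatness: the deviation of the identity chart vanishes identically
    intro ε _
    refine ⟨0, 0, fun τ _ ↦ ?_⟩
    have h0 : Minkowski.vacuumCauchyDevelopment.toCauchyDevelopment.toSpacetime.deviationExtend
        (Minkowski.backgroundOn ⊤) idFlatChart = 0 :=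
      deviationExtend_idFlatChart
    rw [h0, supCkENorm_zero]
    exact zero_le
  · -- (EX) exhaustion by vertical timelike segments (no certified zone: `N = 0`)
    intro τ₁ _
    simp only [iUnion_of_empty, union_empty]
    rintro (x : E4) hx
    -- `x ∈ O` is not flat-late after `τ₁`: `x⁰ ≤ τ₁`
    have hxle : x 0 ≤ τ₁ := not_lt.mp fun hlt ↦ hx.2 ⟨⟨x, trivial⟩, hlt, rfl⟩
    -- so `x` lies vertically below `(τ₁, x̲)`, a point of the flat slab `{x⁰ = τ₁}`
    have hJ : x ∈ Minkowski.vacuumCauchyDevelopment.metric.causalPast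
        Minkowski.vacuumCauchyDevelopment.timeOrientation
        ({E4.ofTimeSpace τ₁ (E4.spatial x)} : Set E4) := by
      refine Minkowski.mem_causalPast_vacuumCauchyDevelopment ?_
      simp only [E4.spatial_ofTimeSpace, sub_self, norm_zero, E4.ofTimeSpace_apply_zero, sub_nonneg]
      exact hxle
    refine LorentzianMetric.causalFuture_mono (M := Minkowski.vacuumCauchyDevelopment.carrier)
      (singleton_subset_iff.mpr ?_) hJ
    exact ⟨⟨E4.ofTimeSpace τ₁ (E4.spatial x), trivial⟩, E4.ofTimeSpace_apply_zero τ₁ (E4.spatial x),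
      rfl⟩

/-- **(F₀) at the model point**: the identity flat chart of Minkowski space is future-oriented on every flat
slab (it pushes `∂₀` to `∂ₜ`, the orienting field of `ℝ⁴₁` itself), a fortiori beyond any flat distance from the
(absent) holes. [cite: arXiv08110354, §5.1] -/
theorem flatOrientation_idFlatChart :
    ∃ ϱ₀ : ℝ, ∀ᶠ τ in atTop, ∀ x ∈ (Minkowski.backgroundOn ⊤).timeSlab τ,
      (∀ i : Fin 0, ϱ₀ ≤ ‖E4.spatial x.1 - (Fin.elim0 : Fin 0 → ℝ → E3) i τ‖) →
        Minkowski.vacuumCauchyDevelopment.toSpacetime.timeOrientation.IsFutureDirected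
          (mfderiv 𝓘(ℝ, E4) (𝓡 4) idFlatChart x (E4.basisVector 0)) :=
  ⟨0, isFutureOriented_minkowskiDecomp.2.2.mono fun _ h x hx _ ↦ h x hx⟩

/-- **THE FULL POST-MAXIMALITY PROPERTY OF THE CRUX HOLDS AT THE MINKOWSKI DEVELOPMENT.** The vacuum Cauchy
development `Minkowski.vacuumCauchyDevelopment` of the trivial datum `(ℝ³, δ, 0)` has complete future null
infinity (sojourn form, `minkowski_hasCompleteNullInfinity`) AND an honest oriented rev-2 final era: the
`N = 0` package `isFinalEra₂_minkowski` with (R) every future-complete normalised null ray from the slice staying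
in `closure {x⁰ ≥ 0}` (`raysStayInClosure_minkowski`), (F) vacuous (no hole) and (F₀) the identity flat chart
future-oriented (`flatOrientation_idFlatChart`). Christodoulou–Klainerman 1993, Thm. 1.0.2.
[cite: ChristodoulouKlainerman1993, Thm. 1.0.2] -/
theorem honestOrientedEra_minkowski :
    letI 𝒟 := Minkowski.vacuumCauchyDevelopment
    Summit.FinalStateConjecture.HasCompleteNullInfinity 𝒟.toCauchyDevelopment ∧
      ∃ (N : ℕ) (M a : Fin N → ℝ) (T δ V C₁ C₂ ρ₀ κ : ℝ) (ξ : Fin N → ℝ → EuclideanSpace ℝ (Fin 3))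
        (β : ℝ → ℝ) (U₀ : TopologicalSpace.Opens E4) (B₀ : ModelBackground) (B : Fin N → ModelBackground)
        (Ψ₀ : B₀.domain → 𝒟.carrier) (Ψ : (i : Fin N) → (B i).domain → 𝒟.carrier) (O : Set 𝒟.carrier),
        𝒟.toCauchyDevelopment.IsFinalEra₂ N M a T δ V C₁ C₂ ρ₀ κ ξ β U₀ B₀ B Ψ₀ Ψ O ∧
          Summit.FinalStateConjecture.RaysStayInClosure 𝒟.toCauchyDevelopment O ∧
            (∀ i (ρ : ℝ), ∀ᶠ τ in atTop, ∀ x ∈ (B i).truncTimeSlab ρ τ,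
              𝒟.toSpacetime.timeOrientation.IsFutureDirected
                (mfderiv 𝓘(ℝ, E4) (𝓡 4) (Ψ i) x (Kerr.timeVector (M i) (a i) x.1))) ∧
              ∃ ϱ₀ : ℝ, ∀ᶠ τ in atTop, ∀ x ∈ B₀.timeSlab τ, (∀ i, ϱ₀ ≤ ‖E4.spatial x.1 - ξ i τ‖) →
                𝒟.toSpacetime.timeOrientation.IsFutureDirected
                  (mfderiv 𝓘(ℝ, E4) (𝓡 4) Ψ₀ x (E4.basisVector 0)) :=
  ⟨minkowski_hasCompleteNullInfinity, 0, Fin.elim0, Fin.elim0, 0, 1, 0, 0, 1, 1, 0, Fin.elim0, fun _ ↦ 0, ⊤,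
    Minkowski.backgroundOn ⊤, fun i ↦ i.elim0, idFlatChart, fun i ↦ i.elim0, minkowskiExterior,
    isFinalEra₂_minkowski, raysStayInClosure_minkowski, fun i ↦ i.elim0, flatOrientation_idFlatChart⟩

/-! ### The whole fibre over the trivial datum -/

/-- **EVERY maximal vacuum Cauchy development of the trivial datum has complete `𝓘⁺` and an honest oriented
rev-2 final era**, unconditionally: such a development is isometric, as a development, to Minkowski space
(`Minkowski.isIsometricTo_vacuumCauchyDevelopment_of_isMaximal`: Minkowski space is geodesically complete, so its
embedding into the MGHD is onto), and the property is transported along the isometry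
(`honestOrientedEra_transport`). [cite: Ringstrom2009, Thm. 16.6] -/
theorem honestOrientedEra_of_isMaximal (𝒟 : VacuumCauchyDevelopment trivialData) (hmax : 𝒟.IsMaximal) :
    Summit.FinalStateConjecture.HasCompleteNullInfinity 𝒟.toCauchyDevelopment ∧
      ∃ (N : ℕ) (M a : Fin N → ℝ) (T δ V C₁ C₂ ρ₀ κ : ℝ) (ξ : Fin N → ℝ → EuclideanSpace ℝ (Fin 3))
        (β : ℝ → ℝ) (U₀ : TopologicalSpace.Opens E4) (B₀ : ModelBackground) (B : Fin N → ModelBackground)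
        (Ψ₀ : B₀.domain → 𝒟.carrier) (Ψ : (i : Fin N) → (B i).domain → 𝒟.carrier) (O : Set 𝒟.carrier),
        𝒟.toCauchyDevelopment.IsFinalEra₂ N M a T δ V C₁ C₂ ρ₀ κ ξ β U₀ B₀ B Ψ₀ Ψ O ∧
          Summit.FinalStateConjecture.RaysStayInClosure 𝒟.toCauchyDevelopment O ∧
            (∀ i (ρ : ℝ), ∀ᶠ τ in atTop, ∀ x ∈ (B i).truncTimeSlab ρ τ,
              𝒟.toSpacetime.timeOrientation.IsFutureDirected
                (mfderiv 𝓘(ℝ, E4) (𝓡 4) (Ψ i) x (Kerr.timeVector (M i) (a i) x.1))) ∧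
              ∃ ϱ₀ : ℝ, ∀ᶠ τ in atTop, ∀ x ∈ B₀.timeSlab τ, (∀ i, ϱ₀ ≤ ‖E4.spatial x.1 - ξ i τ‖) →
                𝒟.toSpacetime.timeOrientation.IsFutureDirected
                  (mfderiv 𝓘(ℝ, E4) (𝓡 4) Ψ₀ x (E4.basisVector 0)) :=
  honestOrientedEra_transport Minkowski.vacuumCauchyDevelopment 𝒟
    (Minkowski.isIsometricTo_vacuumCauchyDevelopment_of_isMaximal hmax) honestOrientedEra_minkowski

/-- **At the trivial datum the crux's per-datum property IS bare MGHD existence** (unconditionally): the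
`∀ MGHD` half holds on the whole fibre (`honestOrientedEra_of_isMaximal`), so `P (trivialData)` reduces to its
anti-vacuity conjunct `∃ 𝒟, 𝒟.IsMaximal` — the trivial datum is exceptional for `FinalEraGeneric` iff it has no
maximal vacuum Cauchy development at all. [cite: ChoquetBruhatGeroch1969CMP, Thm. 3] -/
theorem finalEraProperty_trivialData_iff :
    ((∃ 𝒟 : VacuumCauchyDevelopment trivialData, 𝒟.IsMaximal) ∧
      ∀ 𝒟 : VacuumCauchyDevelopment trivialData, 𝒟.IsMaximal →
        Summit.FinalStateConjecture.HasCompleteNullInfinity 𝒟.toCauchyDevelopment ∧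
          ∃ (N : ℕ) (M a : Fin N → ℝ) (T δ V C₁ C₂ ρ₀ κ : ℝ) (ξ : Fin N → ℝ → EuclideanSpace ℝ (Fin 3))
            (β : ℝ → ℝ) (U₀ : TopologicalSpace.Opens E4) (B₀ : ModelBackground)
            (B : Fin N → ModelBackground) (Ψ₀ : B₀.domain → 𝒟.carrier)
            (Ψ : (i : Fin N) → (B i).domain → 𝒟.carrier) (O : Set 𝒟.carrier),
            𝒟.toCauchyDevelopment.IsFinalEra₂ N M a T δ V C₁ C₂ ρ₀ κ ξ β U₀ B₀ B Ψ₀ Ψ O ∧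
              Summit.FinalStateConjecture.RaysStayInClosure 𝒟.toCauchyDevelopment O ∧
                (∀ i (ρ : ℝ), ∀ᶠ τ in atTop, ∀ x ∈ (B i).truncTimeSlab ρ τ,
                  𝒟.toSpacetime.timeOrientation.IsFutureDirected
                    (mfderiv 𝓘(ℝ, E4) (𝓡 4) (Ψ i) x (Kerr.timeVector (M i) (a i) x.1))) ∧
                  ∃ ϱ₀ : ℝ, ∀ᶠ τ in atTop, ∀ x ∈ B₀.timeSlab τ,
                    (∀ i, ϱ₀ ≤ ‖E4.spatial x.1 - ξ i τ‖) →
                      𝒟.toSpacetime.timeOrientation.IsFutureDirected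
                        (mfderiv 𝓘(ℝ, E4) (𝓡 4) Ψ₀ x (E4.basisVector 0))) ↔
      ∃ 𝒟 : VacuumCauchyDevelopment trivialData, 𝒟.IsMaximal :=
  ⟨fun h ↦ h.1, fun h ↦ ⟨h, honestOrientedEra_of_isMaximal⟩⟩

/-- **THE CRUX'S PER-DATUM PROPERTY HOLDS AT THE TRIVIAL DATUM** (registered helper
`finalEraProperty_trivialData`; given only the Choquet-Bruhat–Geroch existence theorem, through
`Minkowski.isMaximal_vacuumCauchyDevelopment`): an MGHD of `(ℝ³, δ, 0)` exists — Minkowski space — and,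
unconditionally, EVERY MGHD of it has complete `𝓘⁺` and an honest oriented rev-2 final era with (R), (F), (F₀).
So the `∃ ∧ ∀` shape of the crux's property is non-vacuous and TRUE on the fibre over the trivial datum; a
counterexample to the property needs a non-flat admissible datum. [cite: ChoquetBruhatGeroch1969CMP, Thm. 3] -/
theorem finalEraProperty_trivialData : Literature.Geometry.Lorentzian.choquetBruhat_geroch_exists_mghd_cauchy → open scoped Manifold in ((∃ 𝒟 : Literature.Geometry.Lorentzian.VacuumCauchyDevelopment Literature.Geometry.Lorentzian.trivialData, 𝒟.IsMaximal) ∧ ∀ 𝒟 : Literature.Geometry.Lorentzian.VacuumCauchyDevelopment Literature.Geometry.Lorentzian.trivialData, 𝒟.IsMaximal → Summit.FinalStateConjecture.HasCompleteNullInfinity 𝒟.toCauchyDevelopment ∧ ∃ (N : ℕ) (M a : Fin N → ℝ) (T δ V C₁ C₂ ρ₀ κ : ℝ) (ξ : Fin N → ℝ → EuclideanSpace ℝ (Fin 3)) (β : ℝ → ℝ) (U₀ : TopologicalSpace.Opens Literature.Geometry.Lorentzian.E4) (B₀ : Literature.Geometry.Lorentzian.ModelBackground) (B : Fin N → Literature.Geometry.Lorentzian.ModelBackground)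 (Ψ₀ : B₀.domain → 𝒟.carrier) (Ψ : (i : Fin N) → (B i).domain → 𝒟.carrier) (O : Set 𝒟.carrier), 𝒟.toCauchyDevelopment.IsFinalEra₂ N M a T δ V C₁ C₂ ρ₀ κ ξ β U₀ B₀ B Ψ₀ Ψ O ∧ Summit.FinalStateConjecture.RaysStayInClosure 𝒟.toCauchyDevelopment O ∧ (∀ i (ρ : ℝ), ∀ᶠ τ in Filter.atTop, ∀ x ∈ (B i).truncTimeSlab ρ τ, 𝒟.toSpacetime.timeOrientation.IsFutureDirected (mfderiv 𝓘(ℝ, Literature.Geometry.Lorentzian.E4) (𝓡 4) (Ψ i) x (Literature.Geometry.Lorentzian.Kerr.timeVector (M i) (a i) x.1))) ∧ ∃ ϱ₀ : ℝ, ∀ᶠ τ in Filter.atTop, ∀ x ∈ B₀.timeSlab τ, (∀ i, ϱ₀ ≤ ‖Literature.Geometry.Lorentzian.E4.spatial x.1 - ξ i τ‖) → 𝒟.toSpacetime.timeOrientation.IsFutureDirected (mfderiv 𝓘(ℝ, Literature.Geometry.Lorentzian.E4) (𝓡 4) Ψ₀ x (Literature.Geometry.Lorentzian.E4.basisVector 0)))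 :=
  fun hcbg ↦ ⟨⟨_, Minkowski.isMaximal_vacuumCauchyDevelopment hcbg⟩, honestOrientedEra_of_isMaximal⟩

/-- **The post-maximality property of the crux is satisfiable by a vacuum Cauchy development of an ADMISSIBLE
datum** (the trivial datum is admissible, `trivialData_mem_admissibleVacuumData`; the development is Minkowski
space, `honestOrientedEra_minkowski`). Hence the property has NO universal typed defect: the only road to a
refutation of the crux that needs no maximal development in hand — a clause of the post-maximality property
failing in EVERY vacuum Cauchy development of EVERY admissible datum — is closed by a kernel fact.
[cite: ChristodoulouKlainerman1993, Thm. 1.0.2] -/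
theorem exists_admissible_honestOrientedEra :
    ∃ d ∈ admissibleVacuumData Minkowski.slice, ∃ 𝒟 : VacuumCauchyDevelopment d,
      Summit.FinalStateConjecture.HasCompleteNullInfinity 𝒟.toCauchyDevelopment ∧
        ∃ (N : ℕ) (M a : Fin N → ℝ) (T δ V C₁ C₂ ρ₀ κ : ℝ) (ξ : Fin N → ℝ → EuclideanSpace ℝ (Fin 3))
          (β : ℝ → ℝ) (U₀ : TopologicalSpace.Opens E4) (B₀ : ModelBackground) (B : Fin N → ModelBackground)
          (Ψ₀ : B₀.domain → 𝒟.carrier) (Ψ : (i : Fin N) → (B i).domain → 𝒟.carrier) (O : Set 𝒟.carrier),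
          𝒟.toCauchyDevelopment.IsFinalEra₂ N M a T δ V C₁ C₂ ρ₀ κ ξ β U₀ B₀ B Ψ₀ Ψ O ∧
            Summit.FinalStateConjecture.RaysStayInClosure 𝒟.toCauchyDevelopment O ∧
              (∀ i (ρ : ℝ), ∀ᶠ τ in atTop, ∀ x ∈ (B i).truncTimeSlab ρ τ,
                𝒟.toSpacetime.timeOrientation.IsFutureDirected
                  (mfderiv 𝓘(ℝ, E4) (𝓡 4) (Ψ i) x (Kerr.timeVector (M i) (a i) x.1))) ∧
                ∃ ϱ₀ : ℝ, ∀ᶠ τ in atTop, ∀ x ∈ B₀.timeSlab τ, (∀ i, ϱ₀ ≤ ‖E4.spatial x.1 - ξ i τ‖) →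
                  𝒟.toSpacetime.timeOrientation.IsFutureDirected
                    (mfderiv 𝓘(ℝ, E4) (𝓡 4) Ψ₀ x (E4.basisVector 0)) :=
  ⟨trivialData, trivialData_mem_admissibleVacuumData, Minkowski.vacuumCauchyDevelopment,
    honestOrientedEra_minkowski⟩

end Summit.FinalStateConjecture.FinalStateConjecture.Theorems.DissipativeFinalMotions.FinalEraGeneric

end
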